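import Literature.Analysis.FunctionSpaces.LiebWuEnergyStrongCouplingSeries
import Literature.Analysis.FunctionSpaces.LiebWuEnergyDerivative
import Mathlib.Analysis.Calculus.SmoothSeries
import HarnessLib

/-!
# The large-`U` series of the half-filled Lieb–Wu DOUBLE OCCUPANCY (term-by-term derivative of Takahashi's series)

Family `hubbard`. The tree's `liebWuDoubleOccupancy U = d(U) = e'(U)` (`LiebWuEnergyDerivative`:
`hasDerivAt_liebWuEnergy`, the Hellmann–Feynman value `∂e₀/∂U = ⟨n↑n↓⟩` of the half-filled chain under `lieb_wu`)
inherits from Takahashi's convergent series for `e(U)` (`LiebWuEnergyStrongCouplingSeries`; Oitmaa–Hamer–Zheng 2006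
§8.2.1 (8.5)–(8.7): `e(U) = -4 ln 2/U + 9ζ(3)/U³ - 75ζ(5)/U⁵ + (11025/16)ζ(7)/U⁷ - ⋯`, `U > 4`) the series obtained by
differentiating term by term,
`d(U) = 4 ln 2/U² - 27ζ(3)/U⁴ + 375ζ(5)/U⁶ - (77175/16)ζ(7)/U⁸ + ⋯ = 4 ln 2/U² + 4 Σ_{m≥0} (2m+3) c_m/U^{2m+4}`,
`c_m = (-1)^{m+1} γ_{m+1} 2^{2m+3} η(2m+3)` (so that the energy term is `T_m(U) = c_m/U^{2m+3}`), for every `U > 4`: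
a power series in `1/U` may be differentiated term by term inside its disc of convergence — here justified by
Mathlib's `hasDerivAt_tsum_of_isPreconnected` on `(U₀, ∞)`, `4 < U₀ < U`, with the summable majorant
`(2m+3) 16^{m+1}/U₀^{2m+4}` of the derivative terms (`|c_m| ≤ 16^{m+1}`).

* `liebWuStrongCouplingCoeff`, `liebWuStrongCouplingTerm_eq_coeff_div` — `T_m(U) = c_m/U^{2m+3}`, `|c_m| ≤ 16^{m+1}`;
* `hasDerivAt_liebWuStrongCouplingTerm` — `d/dU T_m(U) = -(2m+3) c_m/U^{2m+4}` (`liebWuStrongCouplingTermDeriv`);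
* **`liebWuDoubleOccupancy_eq_strongCoupling_tsum`** — `d(U) = 4 ln 2/U² - 4 Σ' T_m'(U)` for `U > 4`;
* **`abs_liebWuDoubleOccupancy_sub_partialSum_le`** — truncation remainder
  `(4/U²) r^{M+1} ((2M+3)/(1-r) + 2r/(1-r)²)`, `r = 16/U²` (for kernel-checked enclosures of `d(U)`, cf. the cell's
  `M1/TL/n1/U*/D/LiebWu-CERT` rows and the certified double-occupancy brackets `docc@chain:TL:U8:n1`).

No named fact. Printed source of the series being differentiated: Oitmaa–Hamer–Zheng (8.7) / Essler (6.83) / Takahashi 1971;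
the identification `d = e'` is the tree's `hasDerivAt_liebWuEnergy` (Lieb–Wu (20) differentiated under the integral).

## References

* J. Oitmaa, C. Hamer, W. Zheng, CUP 2006, §8.2.1 eq. (8.7) (key `OitmaaHamerZheng2006`).
* E. H. Lieb, F. Y. Wu, PRL 20 (1968) 1445, eq. (20) (key `LiebWuPRL1968`).
* M. Takahashi, Prog. Theor. Phys. 45 (1971) 756 (key `Takahashi1971`; cite-only).
-/

noncomputable section

open Filter Set Real Finset
open scoped Topology

namespace Literature.Analysis.FunctionSpaces

/-! ## The coefficients `c_m` and the derivative terms -/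

/-- `c_m = (-1)^{m+1} γ_{m+1} 2^{2m+3} η(2m+3)`, the coefficient of `U^{-(2m+3)}` in Takahashi's series
(`-4 c_0 = 9ζ(3)·(4/3)·… `: `-4c_0 = 12 η(3) = 9 ζ(3)`, `-4c_1 = -80 η(5)`, `-4c_2 = 700 η(7)`).
[cite: OitmaaHamerZheng2006, §8.2.1 eq. (8.7)] -/
def liebWuStrongCouplingCoeff (m : ℕ) : ℝ :=
  (-1) ^ (m + 1) * besselJ01Moment (m + 1) * 2 ^ (2 * m + 3) * dirichletEta (2 * m + 3)

/-- `T_m(U) = c_m / U^{2m+3}`. [cite: OitmaaHamerZheng2006, §8.2.1 eq. (8.7)] -/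
theorem liebWuStrongCouplingTerm_eq_coeff_div (U : ℝ) (m : ℕ) :
    liebWuStrongCouplingTerm U m = liebWuStrongCouplingCoeff m / U ^ (2 * m + 3) := by
  unfold liebWuStrongCouplingTerm liebWuStrongCouplingCoeff
  rw [div_pow]
  ring

/-- `|c_m| ≤ 16^{m+1}` (`γ_{m+1} ≤ 4^{m+1}/(2(m+2))`, `0 ≤ η ≤ 1`). [cite: OitmaaHamerZheng2006, §8.2.1 eq. (8.6)] -/
theorem abs_liebWuStrongCouplingCoeff_le (m : ℕ) : |liebWuStrongCouplingCoeff m| ≤ 16 ^ (m + 1) := by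
  have hη := dirichletEta_nonneg_le_one (by omega : 2 ≤ 2 * m + 3)
  have hγ := besselJ01Moment_le (m + 1)
  have hγ0 := besselJ01Moment_pos (m + 1)
  have hk : (2 : ℝ) ≤ 2 * (((m + 1 : ℕ) : ℝ) + 1) := by
    have : (0 : ℝ) ≤ ((m + 1 : ℕ) : ℝ) := Nat.cast_nonneg _
    linarith
  have hγ' : besselJ01Moment (m + 1) ≤ 4 ^ (m + 1) / 2 :=
    hγ.trans (div_le_div_of_nonneg_left (by positivity) (by norm_num) hk)
  have e2 : (2 : ℝ) ^ (2 * m + 3) = 2 * 4 ^ (m + 1) := by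
    rw [show 2 * m + 3 = 2 * (m + 1) + 1 by ring, pow_succ, pow_mul]
    norm_num
    ring
  unfold liebWuStrongCouplingCoeff
  rw [abs_mul, abs_mul, abs_mul, abs_pow, abs_neg, abs_one, one_pow, one_mul, abs_of_pos hγ0,
    abs_of_pos (by positivity : (0 : ℝ) < 2 ^ (2 * m + 3)), abs_of_nonneg hη.1]
  calc besselJ01Moment (m + 1) * 2 ^ (2 * m + 3) * dirichletEta (2 * m + 3)
      ≤ besselJ01Moment (m + 1) * 2 ^ (2 * m + 3) := mul_le_of_le_one_right (by positivity) hη.2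
    _ ≤ 4 ^ (m + 1) / 2 * 2 ^ (2 * m + 3) := mul_le_mul_of_nonneg_right hγ' (by positivity)
    _ = 16 ^ (m + 1) := by
        rw [e2, show (16 : ℝ) = 4 * 4 by norm_num, mul_pow]
        ring

/-- The derivative term `T_m'(U) = -(2m+3) c_m / U^{2m+4}`. [cite: OitmaaHamerZheng2006, §8.2.1 eq. (8.7)] -/
def liebWuStrongCouplingTermDeriv (U : ℝ) (m : ℕ) : ℝ :=
  -(2 * (m : ℝ) + 3) * liebWuStrongCouplingCoeff m / U ^ (2 * m + 4)

/-- **`d/dU T_m(U) = -(2m+3) c_m/U^{2m+4}`** for `U ≠ 0`. [cite: OitmaaHamerZheng2006, §8.2.1 eq. (8.7)] -/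
theorem hasDerivAt_liebWuStrongCouplingTerm {U : ℝ} (hU : U ≠ 0) (m : ℕ) :
    HasDerivAt (fun V => liebWuStrongCouplingTerm V m) (liebWuStrongCouplingTermDeriv U m) U := by
  have hfun : (fun V => liebWuStrongCouplingTerm V m) =
      fun V => liebWuStrongCouplingCoeff m * (fun W : ℝ => W ^ (2 * m + 3))⁻¹ V := by
    funext V
    rw [liebWuStrongCouplingTerm_eq_coeff_div]
    simp only [Pi.inv_apply]
    ring
  rw [hfun]
  have h := ((hasDerivAt_pow (2 * m + 3) U).inv (pow_ne_zero _ hU)).const_mul (liebWuStrongCouplingCoeff m)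
  refine h.congr_deriv ?_
  unfold liebWuStrongCouplingTermDeriv
  rw [show 2 * m + 3 - 1 = 2 * m + 2 by omega]
  have hU2 : U ^ (2 * m + 3) ≠ 0 := pow_ne_zero _ hU
  field_simp
  push_cast
  ring

/-- Uniform bound on `(U₀, ∞)`: `|T_m'(V)| ≤ (2m+3) 16^{m+1}/U₀^{2m+4}` for `V > U₀ > 0`.
[cite: OitmaaHamerZheng2006, §8.2.1 eq. (8.7)] -/
theorem abs_liebWuStrongCouplingTermDeriv_le {U₀ V : ℝ} (hU₀ : 0 < U₀) (hV : U₀ < V) (m : ℕ) :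
    |liebWuStrongCouplingTermDeriv V m| ≤ (2 * (m : ℝ) + 3) * 16 ^ (m + 1) / U₀ ^ (2 * m + 4) := by
  have hV0 : 0 < V := hU₀.trans hV
  unfold liebWuStrongCouplingTermDeriv
  rw [abs_div, abs_mul, abs_neg, abs_of_pos (by positivity : (0 : ℝ) < 2 * (m : ℝ) + 3),
    abs_of_pos (by positivity : (0 : ℝ) < V ^ (2 * m + 4))]
  have hc := abs_liebWuStrongCouplingCoeff_le m
  have hpow : U₀ ^ (2 * m + 4) ≤ V ^ (2 * m + 4) := pow_le_pow_left₀ hU₀.le hV.le _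
  calc (2 * (m : ℝ) + 3) * |liebWuStrongCouplingCoeff m| / V ^ (2 * m + 4)
      ≤ (2 * (m : ℝ) + 3) * 16 ^ (m + 1) / V ^ (2 * m + 4) := by gcongr
    _ ≤ (2 * (m : ℝ) + 3) * 16 ^ (m + 1) / U₀ ^ (2 * m + 4) := by
        apply div_le_div_of_nonneg_left (by positivity) (by positivity) hpow

/-- The majorant is summable for `U₀ > 4`: `Σ_m (2m+3) (16/U₀²)^{m+1}/U₀² < ∞`. [cite: OitmaaHamerZheng2006, §8.2.1 eq. (8.7)] -/
theorem summable_strongCouplingDeriv_majorant {U₀ : ℝ} (hU₀ : 4 < U₀) :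
    Summable fun m : ℕ => (2 * (m : ℝ) + 3) * 16 ^ (m + 1) / U₀ ^ (2 * m + 4) := by
  have h0 : 0 < U₀ := by linarith
  set r : ℝ := 16 / U₀ ^ 2 with hr
  have hr0 : 0 ≤ r := by positivity
  have hr1 : r < 1 := by rw [hr, div_lt_one (by positivity)]; nlinarith
  have hrn : ‖r‖ < 1 := by rw [Real.norm_eq_abs, abs_of_nonneg hr0]; exact hr1
  have h1 : Summable fun m : ℕ => (m : ℝ) * r ^ m := (hasSum_coe_mul_geometric_of_norm_lt_one hrn).summable
  have h2 : Summable fun m : ℕ => r ^ m := summable_geometric_of_lt_one hr0 hr1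
  have h3 : Summable fun m : ℕ => r / U₀ ^ 2 * (2 * ((m : ℝ) * r ^ m) + 3 * r ^ m) :=
    ((h1.mul_left 2).add (h2.mul_left 3)).mul_left _
  refine h3.congr fun m => ?_
  rw [hr, div_pow]
  have hU2 : (U₀ ^ 2) ^ m * U₀ ^ 2 * U₀ ^ 2 = U₀ ^ (2 * m + 4) := by rw [← pow_mul]; ring
  rw [← hU2]
  field_simp
  ring

/-! ## Term-by-term differentiation -/

/-- **`d(U) = 4 ln 2/U² - 4 Σ_m T_m'(U)`** for `U > 4` (HasSum form):
`Σ_m T_m'(U)` sums to `(4 ln 2/U² - liebWuDoubleOccupancy U)/4`.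
[cite: OitmaaHamerZheng2006, §8.2.1 eq. (8.7)] -/
theorem hasSum_liebWuStrongCouplingTermDeriv {U : ℝ} (hU : 4 < U) :
    HasSum (liebWuStrongCouplingTermDeriv U) ((4 * Real.log 2 / U ^ 2 - liebWuDoubleOccupancy U) / 4) := by
  have hU0 : 0 < U := by linarith
  obtain ⟨U₀, hU₀, hU₀U⟩ : ∃ U₀ : ℝ, 4 < U₀ ∧ U₀ < U := ⟨(4 + U) / 2, by linarith, by linarith⟩
  have hU₀0 : 0 < U₀ := by linarith
  -- term-by-term derivative of the series on `(U₀, ∞)`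
  have hg : ∀ (m : ℕ) (V : ℝ), V ∈ Ioi U₀ →
      HasDerivAt (fun W => liebWuStrongCouplingTerm W m) (liebWuStrongCouplingTermDeriv V m) V :=
    fun m V hV => hasDerivAt_liebWuStrongCouplingTerm (ne_of_gt (hU₀0.trans hV)) m
  have hg' : ∀ (m : ℕ) (V : ℝ), V ∈ Ioi U₀ →
      ‖liebWuStrongCouplingTermDeriv V m‖ ≤ (2 * (m : ℝ) + 3) * 16 ^ (m + 1) / U₀ ^ (2 * m + 4) := by
    intro m V hV
    rw [Real.norm_eq_abs]
    exact abs_liebWuStrongCouplingTermDeriv_le hU₀0 hV m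
  have hderiv : HasDerivAt (fun V => ∑' m, liebWuStrongCouplingTerm V m)
      (∑' m, liebWuStrongCouplingTermDeriv U m) U :=
    hasDerivAt_tsum_of_isPreconnected (g := fun m V => liebWuStrongCouplingTerm V m)
      (g' := fun m V => liebWuStrongCouplingTermDeriv V m) (t := Ioi U₀) (y₀ := U)
      (summable_strongCouplingDeriv_majorant hU₀) isOpen_Ioi isPreconnected_Ioi hg hg' (mem_Ioi.2 hU₀U)
      (summable_abs_iff.mp (summable_abs_liebWuStrongCouplingTerm hU)) (mem_Ioi.2 hU₀U)
  -- the closed-form part `-4 ln 2 / V`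
  have hlog : HasDerivAt (fun V : ℝ => -4 * Real.log 2 / V) (4 * Real.log 2 / U ^ 2) U := by
    have h := (hasDerivAt_inv hU0.ne').const_mul (-4 * Real.log 2)
    have e1 : (fun V : ℝ => -4 * Real.log 2 / V) = fun V => -4 * Real.log 2 * V⁻¹ := by
      funext V; ring
    rw [e1]
    refine h.congr_deriv ?_
    field_simp
  have hG : HasDerivAt (fun V => -4 * Real.log 2 / V - 4 * ∑' m, liebWuStrongCouplingTerm V m)
      (4 * Real.log 2 / U ^ 2 - 4 * ∑' m, liebWuStrongCouplingTermDeriv U m) U :=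
    hlog.sub (hderiv.const_mul 4)
  -- `e = G` near `U`
  have heq : liebWuEnergy =ᶠ[𝓝 U] fun V => -4 * Real.log 2 / V - 4 * ∑' m, liebWuStrongCouplingTerm V m := by
    filter_upwards [Ioi_mem_nhds hU] with V hV
    exact liebWuEnergy_eq_strongCoupling_tsum hV
  have he : HasDerivAt liebWuEnergy (4 * Real.log 2 / U ^ 2 - 4 * ∑' m, liebWuStrongCouplingTermDeriv U m) U :=
    hG.congr_of_eventuallyEq heq
  have hval : liebWuDoubleOccupancy U = 4 * Real.log 2 / U ^ 2 - 4 * ∑' m, liebWuStrongCouplingTermDeriv U m :=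
    (hasDerivAt_liebWuEnergy hU0).unique he
  -- summability of the derivative terms (dominated by the majorant at `U₀`)
  have hsum : Summable (liebWuStrongCouplingTermDeriv U) := by
    refine Summable.of_norm_bounded (summable_strongCouplingDeriv_majorant hU₀) fun m => ?_
    rw [Real.norm_eq_abs]
    exact abs_liebWuStrongCouplingTermDeriv_le hU₀0 hU₀U m
  have e : (4 * Real.log 2 / U ^ 2 - liebWuDoubleOccupancy U) / 4 = ∑' m, liebWuStrongCouplingTermDeriv U m := by
    rw [hval]; ring
  rw [e]
  exact hsum.hasSum

/-- **The double-occupancy series as an identity**: for `U > 4`,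
`liebWuDoubleOccupancy U = 4 ln 2/U² - 4 Σ' m, T_m'(U) = 4 ln 2/U² + 4 Σ_m (2m+3) c_m/U^{2m+4}`
(`= 4 ln 2/U² - 27ζ(3)/U⁴ + 375ζ(5)/U⁶ - (77175/16)ζ(7)/U⁸ + ⋯`). [cite: OitmaaHamerZheng2006, §8.2.1 eq. (8.7)] -/
theorem liebWuDoubleOccupancy_eq_strongCoupling_tsum {U : ℝ} (hU : 4 < U) :
    liebWuDoubleOccupancy U = 4 * Real.log 2 / U ^ 2 - 4 * ∑' m, liebWuStrongCouplingTermDeriv U m := by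
  rw [(hasSum_liebWuStrongCouplingTermDeriv hU).tsum_eq]
  ring

/-- The tail of the majorant in closed form: `Σ_{m≥0} (2(m+M)+3) r^{m+M+1} = r^{M+1}((2M+3)/(1-r) + 2r/(1-r)²)` for
`0 ≤ r < 1`. [cite: OitmaaHamerZheng2006, §8.2.1 eq. (8.7)] -/
theorem hasSum_shifted_arith_geometric {r : ℝ} (hr0 : 0 ≤ r) (hr1 : r < 1) (M : ℕ) :
    HasSum (fun m : ℕ => (2 * ((m + M : ℕ) : ℝ) + 3) * r ^ (m + M + 1))
      (r ^ (M + 1) * ((2 * M + 3) / (1 - r) + 2 * r / (1 - r) ^ 2)) := by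
  have hrn : ‖r‖ < 1 := by rw [Real.norm_eq_abs, abs_of_nonneg hr0]; exact hr1
  have h1 := hasSum_coe_mul_geometric_of_norm_lt_one hrn
  have h2 := hasSum_geometric_of_lt_one hr0 hr1
  have h := ((h1.mul_left 2).add (h2.mul_left (2 * (M : ℝ) + 3))).mul_left (r ^ (M + 1))
  have e1 : (fun m : ℕ => (2 * ((m + M : ℕ) : ℝ) + 3) * r ^ (m + M + 1)) =
      fun i : ℕ => r ^ (M + 1) * (2 * ((i : ℝ) * r ^ i) + (2 * (M : ℝ) + 3) * r ^ i) := by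
    funext m
    push_cast
    rw [show m + M + 1 = (M + 1) + m by ring, pow_add]
    ring
  have e2 : r ^ (M + 1) * ((2 * M + 3) / (1 - r) + 2 * r / (1 - r) ^ 2) =
      r ^ (M + 1) * (2 * (r / (1 - r) ^ 2) + (2 * (M : ℝ) + 3) * (1 - r)⁻¹) := by
    ring
  rw [e1, e2]
  exact h

/-- **Truncation with explicit remainder**: for `U > 4`, `r = 16/U²`, every `M`,
`|d(U) - (4 ln 2/U² - 4 Σ_{m<M} T_m'(U))| ≤ (4/U²) r^{M+1} ((2M+3)/(1-r) + 2r/(1-r)²)`.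
[cite: OitmaaHamerZheng2006, §8.2.1 eq. (8.7)] -/
theorem abs_liebWuDoubleOccupancy_sub_partialSum_le {U : ℝ} (hU : 4 < U) (M : ℕ) :
    |liebWuDoubleOccupancy U - (4 * Real.log 2 / U ^ 2 - 4 * ∑ m ∈ range M, liebWuStrongCouplingTermDeriv U m)| ≤
      4 / U ^ 2 * (16 / U ^ 2) ^ (M + 1) * ((2 * M + 3) / (1 - 16 / U ^ 2) + 2 * (16 / U ^ 2) / (1 - 16 / U ^ 2) ^ 2) := by
  have hU0 : 0 < U := by linarith
  have hr0 : (0 : ℝ) ≤ 16 / U ^ 2 := by positivity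
  have hr1 : 16 / U ^ 2 < 1 := by rw [div_lt_one (by positivity)]; nlinarith
  have h := hasSum_liebWuStrongCouplingTermDeriv hU
  have htail := (hasSum_nat_add_iff' M).mpr h
  have hmaj : ∀ m, |liebWuStrongCouplingTermDeriv U (m + M)| ≤
      4 / U ^ 2 * ((2 * ((m + M : ℕ) : ℝ) + 3) * (16 / U ^ 2) ^ (m + M + 1)) / 4 := by
    intro m
    have hV : |liebWuStrongCouplingTermDeriv U (m + M)| ≤
        (2 * ((m + M : ℕ) : ℝ) + 3) * 16 ^ (m + M + 1) / U ^ (2 * (m + M) + 4) := by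
      unfold liebWuStrongCouplingTermDeriv
      rw [abs_div, abs_mul, abs_neg, abs_of_pos (by positivity : (0 : ℝ) < 2 * ((m + M : ℕ) : ℝ) + 3),
        abs_of_pos (by positivity : (0 : ℝ) < U ^ (2 * (m + M) + 4))]
      have hc := abs_liebWuStrongCouplingCoeff_le (m + M)
      gcongr
    refine hV.trans (le_of_eq ?_)
    rw [show 2 * (m + M) + 4 = 2 * (m + M + 1) + 2 by ring, pow_add, div_pow, ← pow_mul]
    field_simp
    ring
  have habs : Summable fun m => |liebWuStrongCouplingTermDeriv U (m + M)| := by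
    refine Summable.of_nonneg_of_le (fun m => abs_nonneg _) hmaj ?_
    exact ((hasSum_shifted_arith_geometric hr0 hr1 M).mul_left (4 / U ^ 2)).div_const 4 |>.summable
  have hbound : |∑' m, liebWuStrongCouplingTermDeriv U (m + M)| ≤
      4 / U ^ 2 * ((16 / U ^ 2) ^ (M + 1) * ((2 * M + 3) / (1 - 16 / U ^ 2) +
        2 * (16 / U ^ 2) / (1 - 16 / U ^ 2) ^ 2)) / 4 := by
    have hn := norm_tsum_le_tsum_norm (f := fun m => liebWuStrongCouplingTermDeriv U (m + M))
      (by simpa only [Real.norm_eq_abs] using habs)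
    simp only [Real.norm_eq_abs] at hn
    refine hn.trans ?_
    have hs := ((hasSum_shifted_arith_geometric hr0 hr1 M).mul_left (4 / U ^ 2)).div_const 4
    rw [← hs.tsum_eq]
    exact habs.tsum_le_tsum hmaj hs.summable
  have e : liebWuDoubleOccupancy U - (4 * Real.log 2 / U ^ 2 - 4 * ∑ m ∈ range M, liebWuStrongCouplingTermDeriv U m) =
      -4 * ∑' m, liebWuStrongCouplingTermDeriv U (m + M) := by
    rw [htail.tsum_eq]
    ring
  rw [e, abs_mul, abs_neg, abs_of_pos (by norm_num : (0 : ℝ) < 4)]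
  calc 4 * |∑' m, liebWuStrongCouplingTermDeriv U (m + M)|
      ≤ 4 * (4 / U ^ 2 * ((16 / U ^ 2) ^ (M + 1) * ((2 * M + 3) / (1 - 16 / U ^ 2) +
        2 * (16 / U ^ 2) / (1 - 16 / U ^ 2) ^ 2)) / 4) := by gcongr
    _ = 4 / U ^ 2 * (16 / U ^ 2) ^ (M + 1) * ((2 * M + 3) / (1 - 16 / U ^ 2) +
        2 * (16 / U ^ 2) / (1 - 16 / U ^ 2) ^ 2) := by ring

end Literature.Analysis.FunctionSpaces
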